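import Literature.NumberTheory.LFunctions.TrilinearKloostermanFractionsAmplifiedForm
import Literature.NumberTheory.LFunctions.TrilinearKloostermanFractionsOptimiseL
import Literature.NumberTheory.LFunctions.TrilinearKloostermanFractionsFromCbTools
import Literature.NumberTheory.LFunctions.KloostermanFractionsParams
import HarnessLib

/-!
# Trilinear forms with Kloosterman fractions: from the diagonal and off-diagonal bounds to (5.1)–(5.2)

Topic `NumberTheory/LFunctions`.  S. Bettin, V. Chandee, *Trilinear forms with Kloosterman
fractions*, Adv. Math. 328 (2018), §5: "Combining (2.4) with the bounds for the diagonal (3.5)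
and off-diagonal terms (4.25) we obtain
`𝓓_b ≪ ‖β‖²‖ν‖² (1+|ϑ|A/(bNM))^{1/2} L M^ε (A(bLN)^{1/2} + AM/(bN) + M + b^{3/4}AN^{5/4}L^{1/2}/M^{1/2} + b^{1/2}AL^{5/2}N^{7/4}/M + b^{1/2}A^{1/2}N)`
and thus, by (2.2),
(5.1) `𝓒_b ≪ ‖β‖²‖ν‖² M^ε (1+|ϑ|A/(bNM))^{1/2} (AM(bN)^{1/2}/L^{1/2} + AM²/(bLN) + M²/L + b^{3/4}AM^{1/2}N^{5/4}/L^{1/2} + b^{1/2}AL^{3/2}N^{7/4} + b^{1/2}A^{1/2}MN/L)`",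
the amplifier `𝓛 = {ℓ ∈ (L,2L] prime, (ℓ, ϑb) = 1}` being admissible "provided that
`L > 2 log(bϑM)`" (§2).  This file PROVES that passage for the general-`A`, TWISTED moments of the
reduction of the named fact `BettinChandee2018_trilinearKloostermanFractions`:

* **`BC_CbA_bound_of_diagA_offA`** — hypotheses: bounds of the shapes (3.5) (`× L`, the length of
  the amplifier) and (4.25) for the diagonal and off-diagonal parts (`ℓ₁n₁ = ℓ₂n₂`, resp. `≠`) of
  the orthogonality expansion of the amplified moment with coefficients
  `c_m(n') = γ_{n'} ∑_a ν_a e(ϑ a m̄^{(bn')}/(bn') + η a/(m bn'))` and the amplifier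
  `{ℓ ∈ (L,2L] prime, (ℓ, bϑ) = 1}`, for every integer `L ≥ 1` (with the factor
  `((1+|ϑ|+|η|)bMN'A)^ε` for the source's `M^ε` and Remark 2's factor with exponent `1`);
  conclusion: (5.2) in the shape `h52` consumed by `BC_C1A_bound_of_CbA_bound`
  (`TrilinearKloostermanFractionsFromCb.lean`).  Proof as in the source: the amplified inequality
  `BC_amplified_moment_le_diag_add_off` (`TrilinearKloostermanFractionsAmplifiedForm.lean`) with
  `P ≥ L/(4 log L)` amplifying primes coprime to `m` once `L ≥ 4 log(8x) + 2`
  (`kfp_primes_coprime_card`, `DFI_card_primes_Ioc_ge`), the multiplication by `32 M (log L)²/L²`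
  giving the six terms of (5.1), `(log L)² ≪ L^{2δ}`, the trivial bound (`BC_CbAtw_trivial`) in the
  range `L ≥ M`, and finally `BC_CbA_bound_of_LA_bound` (the choice of `L`, §5).

So, for the named fact, what remains of the source is §3 (the diagonal terms, (3.5)) and §4 (the
off-diagonal terms, (4.25)) for these coefficients: the hypotheses `hD`, `hO` below.  No new named
facts (D-0026).

## References

* S. Bettin, V. Chandee, Adv. Math. 328 (2018) 1234–1262 (arXiv:1502.00769), §2 ((2.2)–(2.4)),
  §3 (3.5), §4 (4.25), §5 ((5.1), (5.2)). [BettinChandee2018]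
* W. Duke, J. Friedlander, H. Iwaniec, Invent. Math. 128 (1997) 23–43, §3. [DukeFriedlanderIwaniec1997]
-/

noncomputable section

open Finset Real

namespace Literature.NumberTheory.LFunctions

set_option maxHeartbeats 800000 in
/-- **Bettin–Chandee (2.2) + (3.5) + (4.25) ⟹ (5.1) ⟹ (5.2)** for the twisted trilinear
`𝓒_b`-moments (general `A`; module docstring).  `hD`: for every integer `L ≥ 1`, the diagonal part
of the amplified expansion is at most
`K ‖γ‖²‖ν‖² ((1+|ϑ|+|η|)bMN'A)^ε (1+(|ϑ|+|η|)A/(bN'M)) · L (A(bLN')^{1/2} + AM/(bN') + M)`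
((3.5) × `L`); `hO`: the off-diagonal part is at most
`K ‖γ‖²‖ν‖² (…)^ε (…) · b^{1/2} A L N'^{3/4} (b^{1/4}N'^{1/2}L^{1/2}M^{-1/2} + L^{5/2}N'/M + N'^{1/4}A^{-1/2})`
((4.25) with `(b + |ϑ|A/(NM))^{1/2} = b^{1/2}(1 + |ϑ|A/(bNM))^{1/2}`).  Conclusion: (5.2), the
hypothesis `h52` of `BC_C1A_bound_of_CbA_bound`. [cite: BettinChandee2018, §§2, 5 ((2.2), (5.1), (5.2))] -/
theorem BC_CbA_bound_of_diagA_offA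
    (hD : ∀ ε : ℝ, 0 < ε → ∃ K : ℝ, 0 < K ∧ ∀ (b : ℕ), 0 < b → (∀ p ∈ b.primeFactors, p ^ 2 ∣ b) →
      ∀ (M N' A : ℝ), 1 / 2 ≤ M → 1 / 2 ≤ N' → (b : ℝ) ≤ N' → (b : ℝ) * N' ≤ M → 1 / 2 ≤ A →
      ∀ (ϑ : ℤ), ϑ ≠ 0 → b.Coprime ϑ.natAbs → ∀ (η : ℝ) (γ ν : ℕ → ℂ),
        (∀ n : ℕ, γ n ≠ 0 → N' < n ∧ (n : ℝ) ≤ 2 * N') →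
        (∀ n : ℕ, γ n ≠ 0 → Squarefree n ∧ n.Coprime b ∧ n.Coprime ϑ.natAbs) →
        (∀ a : ℕ, ν a ≠ 0 → A < a ∧ (a : ℝ) ≤ 2 * A) →
        ∀ L : ℕ, 1 ≤ L →
        ‖∑ m ∈ (Ioc ⌊M⌋₊ ⌊2 * M⌋₊).filter (fun m => m.Coprime b), ∑ ℓ₁ ∈ ((Ioc L (2 * L)).filter (fun ℓ => ℓ.Prime ∧ ℓ.Coprime b ∧ ℓ.Coprime ϑ.natAbs)), ∑ n₁ ∈ Icc 1 ⌊2 * N'⌋₊,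
          ∑ ℓ₂ ∈ ((Ioc L (2 * L)).filter (fun ℓ => ℓ.Prime ∧ ℓ.Coprime b ∧ ℓ.Coprime ϑ.natAbs)), ∑ n₂ ∈ Icc 1 ⌊2 * N'⌋₊,
            (if ℓ₁ * n₁ = ℓ₂ * n₂ then
            (if (ℓ₂ * n₂).Coprime m ∧ ((ℓ₁ * n₁ : ℕ) : ZMod m) = ((ℓ₂ * n₂ : ℕ) : ZMod m) then
              (γ n₁ * ∑ a ∈ Icc 1 ⌊2 * A⌋₊, ν a * Complex.exp (2 * Real.pi * Complex.I *
                ((ϑ : ℂ) * (a : ℂ) * ((((m : ZMod (b * n₁))⁻¹).val : ℕ) : ℂ) / ((b * n₁ : ℕ) : ℂ) +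
                  (η : ℂ) * (a : ℂ) / ((m : ℂ) * ((b * n₁ : ℕ) : ℂ))))) *
              (starRingEnd ℂ) (γ n₂ * ∑ a ∈ Icc 1 ⌊2 * A⌋₊, ν a * Complex.exp (2 * Real.pi * Complex.I *
                ((ϑ : ℂ) * (a : ℂ) * ((((m : ZMod (b * n₂))⁻¹).val : ℕ) : ℂ) / ((b * n₂ : ℕ) : ℂ) +
                  (η : ℂ) * (a : ℂ) / ((m : ℂ) * ((b * n₂ : ℕ) : ℂ))))) else 0) else 0)‖ ≤
          K * (∑ n ∈ Icc 1 ⌊2 * N'⌋₊, ‖γ n‖ ^ 2) * (∑ a ∈ Icc 1 ⌊2 * A⌋₊, ‖ν a‖ ^ 2) *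
            ((1 + |(ϑ : ℝ)| + |η|) * ((b : ℝ) * M * N' * A)) ^ ε * (1 + (|(ϑ : ℝ)| + |η|) * A / ((b : ℝ) * N' * M)) *
            ((L : ℝ) * (A * ((b : ℝ) * (L : ℝ) * N') ^ (1 / 2 : ℝ) + A * M / ((b : ℝ) * N') + M)))
    (hO : ∀ ε : ℝ, 0 < ε → ∃ K : ℝ, 0 < K ∧ ∀ (b : ℕ), 0 < b → (∀ p ∈ b.primeFactors, p ^ 2 ∣ b) →
      ∀ (M N' A : ℝ), 1 / 2 ≤ M → 1 / 2 ≤ N' → (b : ℝ) ≤ N' → (b : ℝ) * N' ≤ M → 1 / 2 ≤ A →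
      ∀ (ϑ : ℤ), ϑ ≠ 0 → b.Coprime ϑ.natAbs → ∀ (η : ℝ) (γ ν : ℕ → ℂ),
        (∀ n : ℕ, γ n ≠ 0 → N' < n ∧ (n : ℝ) ≤ 2 * N') →
        (∀ n : ℕ, γ n ≠ 0 → Squarefree n ∧ n.Coprime b ∧ n.Coprime ϑ.natAbs) →
        (∀ a : ℕ, ν a ≠ 0 → A < a ∧ (a : ℝ) ≤ 2 * A) →
        ∀ L : ℕ, 1 ≤ L →
        ‖∑ m ∈ (Ioc ⌊M⌋₊ ⌊2 * M⌋₊).filter (fun m => m.Coprime b), ∑ ℓ₁ ∈ ((Ioc L (2 * L)).filter (fun ℓ => ℓ.Prime ∧ ℓ.Coprime b ∧ ℓ.Coprime ϑ.natAbs)), ∑ n₁ ∈ Icc 1 ⌊2 * N'⌋₊,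
          ∑ ℓ₂ ∈ ((Ioc L (2 * L)).filter (fun ℓ => ℓ.Prime ∧ ℓ.Coprime b ∧ ℓ.Coprime ϑ.natAbs)), ∑ n₂ ∈ Icc 1 ⌊2 * N'⌋₊,
            (if ℓ₁ * n₁ = ℓ₂ * n₂ then 0 else
            (if (ℓ₂ * n₂).Coprime m ∧ ((ℓ₁ * n₁ : ℕ) : ZMod m) = ((ℓ₂ * n₂ : ℕ) : ZMod m) then
              (γ n₁ * ∑ a ∈ Icc 1 ⌊2 * A⌋₊, ν a * Complex.exp (2 * Real.pi * Complex.I *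
                ((ϑ : ℂ) * (a : ℂ) * ((((m : ZMod (b * n₁))⁻¹).val : ℕ) : ℂ) / ((b * n₁ : ℕ) : ℂ) +
                  (η : ℂ) * (a : ℂ) / ((m : ℂ) * ((b * n₁ : ℕ) : ℂ))))) *
              (starRingEnd ℂ) (γ n₂ * ∑ a ∈ Icc 1 ⌊2 * A⌋₊, ν a * Complex.exp (2 * Real.pi * Complex.I *
                ((ϑ : ℂ) * (a : ℂ) * ((((m : ZMod (b * n₂))⁻¹).val : ℕ) : ℂ) / ((b * n₂ : ℕ) : ℂ) +
                  (η : ℂ) * (a : ℂ) / ((m : ℂ) * ((b * n₂ : ℕ) : ℂ))))) else 0))‖ ≤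
          K * (∑ n ∈ Icc 1 ⌊2 * N'⌋₊, ‖γ n‖ ^ 2) * (∑ a ∈ Icc 1 ⌊2 * A⌋₊, ‖ν a‖ ^ 2) *
            ((1 + |(ϑ : ℝ)| + |η|) * ((b : ℝ) * M * N' * A)) ^ ε * (1 + (|(ϑ : ℝ)| + |η|) * A / ((b : ℝ) * N' * M)) *
            ((b : ℝ) ^ (1 / 2 : ℝ) * A * (L : ℝ) * N' ^ (3 / 4 : ℝ) *
              ((b : ℝ) ^ (1 / 4 : ℝ) * N' ^ (1 / 2 : ℝ) * (L : ℝ) ^ (1 / 2 : ℝ) * M ^ (-(1 / 2) : ℝ) +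
                (L : ℝ) ^ (5 / 2 : ℝ) * N' / M + N' ^ (1 / 4 : ℝ) * A ^ (-(1 / 2) : ℝ)))) :
    ∀ ε : ℝ, 0 < ε → ∃ K : ℝ, 0 < K ∧ ∀ (b : ℕ), 0 < b → (∀ p ∈ b.primeFactors, p ^ 2 ∣ b) →
      ∀ (M N' A : ℝ), 1 / 2 ≤ M → 1 / 2 ≤ N' → (b : ℝ) ≤ N' → (b : ℝ) * N' ≤ M → 1 / 2 ≤ A →
      ∀ (ϑ : ℤ), ϑ ≠ 0 → b.Coprime ϑ.natAbs → ∀ (η : ℝ) (γ ν : ℕ → ℂ),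
        (∀ n : ℕ, γ n ≠ 0 → N' < n ∧ (n : ℝ) ≤ 2 * N') →
        (∀ n : ℕ, γ n ≠ 0 → Squarefree n ∧ n.Coprime b ∧ n.Coprime ϑ.natAbs) →
        (∀ a : ℕ, ν a ≠ 0 → A < a ∧ (a : ℝ) ≤ 2 * A) →
        ∑ m ∈ (Ioc ⌊M⌋₊ ⌊2 * M⌋₊).filter (fun m => m.Coprime b),
            ‖∑ n' ∈ (Icc 1 ⌊2 * N'⌋₊).filter (fun n' => n'.Coprime m),
              γ n' * ∑ a ∈ Icc 1 ⌊2 * A⌋₊, ν a * Complex.exp (2 * Real.pi * Complex.I *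
                ((ϑ : ℂ) * (a : ℂ) * ((((m : ZMod (b * n'))⁻¹).val : ℕ) : ℂ) / ((b * n' : ℕ) : ℂ) +
                  (η : ℂ) * (a : ℂ) / ((m : ℂ) * ((b * n' : ℕ) : ℂ))))‖ ^ 2 ≤
          K * (∑ n ∈ Icc 1 ⌊2 * N'⌋₊, ‖γ n‖ ^ 2) * (∑ a ∈ Icc 1 ⌊2 * A⌋₊, ‖ν a‖ ^ 2) *
            ((1 + |(ϑ : ℝ)| + |η|) * ((b : ℝ) * M * N' * A)) ^ ε *
            (1 + (|(ϑ : ℝ)| + |η|) * A / ((b : ℝ) * N' * M)) *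
            (A * M * ((b : ℝ) * N') ^ (1 / 2 : ℝ) +
              (b : ℝ) ^ (3 / 4 : ℝ) * A * M ^ (1 / 2 : ℝ) * N' ^ (5 / 4 : ℝ) +
              A * M ^ (6 / 5 : ℝ) * N' ^ (1 / 10 : ℝ) * (b : ℝ) ^ (-(2 / 5) : ℝ) +
              (b : ℝ) ^ (1 / 5 : ℝ) * A ^ (2 / 5 : ℝ) * M ^ (6 / 5 : ℝ) * N' ^ (7 / 10 : ℝ) +
              A ^ (7 / 10 : ℝ) * (b : ℝ) ^ (1 / 2 : ℝ) * M ^ (3 / 5 : ℝ) * N' ^ (13 / 10 : ℝ) +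
              (b : ℝ) ^ (1 / 2 : ℝ) * A * N' ^ (7 / 4 : ℝ)) := by
  classical
  obtain ⟨L₀, hL₀⟩ := DFI_card_primes_Ioc_ge
  -- the admissibility threshold `Lmin = max(L₀ + 2, 4 log(8x) + 2)`, `x = (1+|ϑ|+|η|) bMN'A`
  refine BC_CbA_bound_of_LA_bound
    (fun b M N' A ϑ η => max ((L₀ : ℝ) + 2)
      (4 * Real.log (8 * ((1 + |(ϑ : ℝ)| + |η|) * ((b : ℝ) * M * N' * A))) + 2)) ?_ ?_
  · -- `Lmin ≤ C (1 + log (1 + x))`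
    refine ⟨(L₀ : ℝ) + 16, by positivity, ?_⟩
    intro b M N' A ϑ η hb hM hN' hA
    have hb0 : (0 : ℝ) < b := by exact_mod_cast hb
    have hM0 : 0 < M := by linarith
    have hN0 : 0 < N' := by linarith
    have hA0 : 0 < A := by linarith
    set x : ℝ := (1 + |(ϑ : ℝ)| + |η|) * ((b : ℝ) * M * N' * A) with hx
    have hx0 : 0 < x := by positivity
    have hlog1 : 0 ≤ Real.log (1 + x) := Real.log_nonneg (by linarith)
    have hlog8 : Real.log 8 ≤ 3 := by
      have h := Real.log_two_lt_d9
      rw [show (8 : ℝ) = 2 ^ 3 by norm_num, Real.log_pow]; push_cast; linarith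
    have hlog8x : Real.log (8 * x) ≤ 3 + Real.log (1 + x) := by
      rw [Real.log_mul (by norm_num) hx0.ne']
      have : Real.log x ≤ Real.log (1 + x) := Real.log_le_log hx0 (by linarith)
      linarith
    have hL₀0 : (0 : ℝ) ≤ L₀ := Nat.cast_nonneg _
    refine max_le ?_ ?_
    · nlinarith
    · nlinarith
  · -- (5.1) for every admissible `L`
    intro ε hε
    obtain ⟨KD, hKD0, hKD⟩ := hD (ε / 2) (by positivity)
    obtain ⟨KO, hKO0, hKO⟩ := hO (ε / 2) (by positivity)
    set δ : ℝ := ε / 8 with hδ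
    have hδ0 : 0 < δ := by positivity
    refine ⟨32 * (4 : ℝ) ^ ε + 64 * (KD + KO) * (8 : ℝ) ^ (ε / 4) / δ ^ 2, by positivity, ?_⟩
    intro b hb hbfull M N' A hM hN' hbN hbNM hA ϑ hϑ hbk η γ ν hγ hγ2 hν L hLminL hL1
    have hb0 : (0 : ℝ) < b := by exact_mod_cast hb
    have hb1 : (1 : ℝ) ≤ b := by exact_mod_cast hb
    have hM0 : 0 < M := by linarith
    have hN0 : 0 < N' := by linarith
    have hA0 : 0 < A := by linarith
    have hL0 : 0 < L := by linarith
    -- abbreviations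
    obtain ⟨x, hx⟩ : ∃ x : ℝ, x = (1 + |(ϑ : ℝ)| + |η|) * ((b : ℝ) * M * N' * A) := ⟨_, rfl⟩
    have h1ϑη : (2 : ℝ) ≤ 1 + |(ϑ : ℝ)| + |η| := by
      have : (1 : ℝ) ≤ |(ϑ : ℝ)| := by rw [← Int.cast_abs]; exact_mod_cast Int.one_le_abs hϑ
      linarith [abs_nonneg η]
    have hx0 : 0 < x := by rw [hx]; positivity
    have hxM : M ≤ 2 * x := by
      rw [hx]
      have h2 : (1 : ℝ) * M * (1 / 2) * (1 / 2) ≤ (b : ℝ) * M * N' * A := by gcongr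
      have h3 := mul_le_mul h1ϑη h2 (by positivity) (by linarith [abs_nonneg (ϑ : ℝ), abs_nonneg η])
      linarith
    have hx14 : 1 / 4 ≤ x := by
      have h2 : (1 : ℝ) * (1 / 2) * (1 / 2) * (1 / 2) ≤ (b : ℝ) * M * N' * A := by gcongr
      rw [hx]; nlinarith
    obtain ⟨Wv, hWv⟩ : ∃ w : ℝ, w = 1 + (|(ϑ : ℝ)| + |η|) * A / ((b : ℝ) * N' * M) := ⟨_, rfl⟩
    have hW1 : 1 ≤ Wv := by
      have : 0 ≤ (|(ϑ : ℝ)| + |η|) * A / ((b : ℝ) * N' * M) := by positivity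
      rw [hWv]; linarith
    have hW0 : 0 ≤ Wv := by linarith
    obtain ⟨nrm, hnrm⟩ : ∃ t : ℝ, t = (∑ n ∈ Icc 1 ⌊2 * N'⌋₊, ‖γ n‖ ^ 2) *
        (∑ a ∈ Icc 1 ⌊2 * A⌋₊, ‖ν a‖ ^ 2) := ⟨_, rfl⟩
    have hnrm0 : 0 ≤ nrm := by
      rw [hnrm]; exact mul_nonneg (Finset.sum_nonneg fun _ _ => sq_nonneg _)
        (Finset.sum_nonneg fun _ _ => sq_nonneg _)
    -- the six terms of (5.1) at a real `L'`
    obtain ⟨T51, hT51⟩ : ∃ f : ℝ → ℝ, f = fun L' =>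
        A * M * ((b : ℝ) * N') ^ (1 / 2 : ℝ) * L' ^ (-(1 / 2) : ℝ) + A * M ^ 2 / ((b : ℝ) * L' * N') +
        M ^ 2 / L' + (b : ℝ) ^ (3 / 4 : ℝ) * A * M ^ (1 / 2 : ℝ) * N' ^ (5 / 4 : ℝ) * L' ^ (-(1 / 2) : ℝ) +
        (b : ℝ) ^ (1 / 2 : ℝ) * A * L' ^ (3 / 2 : ℝ) * N' ^ (7 / 4 : ℝ) +
        (b : ℝ) ^ (1 / 2 : ℝ) * A ^ (1 / 2 : ℝ) * M * N' / L' := ⟨_, rfl⟩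
    have hT51L0 : 0 ≤ T51 L := by rw [hT51]; positivity
    -- `1 ≤ (4x)^ε = 4^ε x^ε`
    have h4x : 1 ≤ (4 : ℝ) ^ ε * x ^ ε := by
      rw [← Real.mul_rpow (by norm_num) hx0.le]
      exact Real.one_le_rpow (by linarith) hε.le
    -- restate the goal with the abbreviations
    suffices hgoal : ∑ m ∈ (Ioc ⌊M⌋₊ ⌊2 * M⌋₊).filter (fun m => m.Coprime b),
            ‖∑ n' ∈ (Icc 1 ⌊2 * N'⌋₊).filter (fun n' => n'.Coprime m),
              γ n' * ∑ a ∈ Icc 1 ⌊2 * A⌋₊, ν a * Complex.exp (2 * Real.pi * Complex.I *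
                ((ϑ : ℂ) * (a : ℂ) * ((((m : ZMod (b * n'))⁻¹).val : ℕ) : ℂ) / ((b * n' : ℕ) : ℂ) +
                  (η : ℂ) * (a : ℂ) / ((m : ℂ) * ((b * n' : ℕ) : ℂ))))‖ ^ 2 ≤
        (32 * (4 : ℝ) ^ ε + 64 * (KD + KO) * (8 : ℝ) ^ (ε / 4) / δ ^ 2) * nrm * x ^ ε * Wv * T51 L by
      rw [hnrm, hx, hWv, hT51] at hgoal
      calc _ ≤ _ := hgoal
        _ = _ := by ring
    have hK2 : 0 ≤ 64 * (KD + KO) * (8 : ℝ) ^ (ε / 4) / δ ^ 2 * nrm * x ^ ε * Wv * T51 L := by positivity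
    have hK1 : 0 ≤ 32 * (4 : ℝ) ^ ε * nrm * x ^ ε * Wv * T51 L := by positivity
    by_cases hLM : M ≤ L
    · -- the trivial range `L ≥ M`
      have htriv := BC_CbAtw_trivial b hM0.le hN0.le hA0.le ϑ η γ ν (M := M) (N' := N') (A := A)
      have h1 : A * M * N' ≤ 4 * T51 L := by
        rw [hT51]; exact BC_AMN_le_terms51A hb hM0 hN' hA0 hL1 hLM
      calc _ ≤ 8 * A * M * N' * (∑ n ∈ Icc 1 ⌊2 * N'⌋₊, ‖γ n‖ ^ 2) *
            (∑ a ∈ Icc 1 ⌊2 * A⌋₊, ‖ν a‖ ^ 2) := htriv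
        _ = 8 * (A * M * N') * nrm := by rw [hnrm]; ring
        _ ≤ 8 * (4 * T51 L) * nrm := by gcongr
        _ = 32 * nrm * T51 L * 1 * 1 := by ring
        _ ≤ 32 * nrm * T51 L * ((4 : ℝ) ^ ε * x ^ ε) * Wv := by gcongr
        _ = 32 * (4 : ℝ) ^ ε * nrm * x ^ ε * Wv * T51 L := by ring
        _ ≤ _ := by
            have e : (32 * (4 : ℝ) ^ ε + 64 * (KD + KO) * (8 : ℝ) ^ (ε / 4) / δ ^ 2) * nrm * x ^ ε * Wv * T51 L =
                32 * (4 : ℝ) ^ ε * nrm * x ^ ε * Wv * T51 L +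
                64 * (KD + KO) * (8 : ℝ) ^ (ε / 4) / δ ^ 2 * nrm * x ^ ε * Wv * T51 L := by ring
            rw [e]; exact le_add_of_nonneg_right hK2
    · -- the main range `L < M`: amplification with the primes of `(⌊L⌋, 2⌊L⌋]`
      have hLM' : L < M := not_le.mp hLM
      set Li : ℕ := ⌊L⌋₊ with hLi
      have hLmin2 : (L₀ : ℝ) + 2 ≤ L := le_trans (le_max_left _ _) hLminL
      have hLminlog : 4 * Real.log (8 * x) + 2 ≤ L := by
        rw [hx]; exact le_trans (le_max_right _ _) hLminL
      have hLiL : (Li : ℝ) ≤ L := Nat.floor_le hL0.le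
      have hLLi : L < (Li : ℝ) + 1 := Nat.lt_floor_add_one L
      have hLi2 : 2 ≤ Li := by
        rw [hLi, Nat.le_floor_iff hL0.le]; push_cast; linarith [(Nat.cast_nonneg L₀ : (0:ℝ) ≤ L₀)]
      have hLiL₀ : L₀ ≤ Li := by
        rw [hLi, Nat.le_floor_iff hL0.le]; linarith
      have hLi1 : (1 : ℝ) ≤ Li := by exact_mod_cast (show 1 ≤ Li by omega)
      have hLr0 : (0 : ℝ) < Li := by linarith
      have hlogLi : 0 < Real.log Li := Real.log_pos (by exact_mod_cast (show 1 < Li by omega))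
      -- abbreviate the diagonal / off-diagonal bounds
      obtain ⟨QD, hQD⟩ : ∃ q : ℝ, q = (Li : ℝ) * (A * ((b : ℝ) * (Li : ℝ) * N') ^ (1 / 2 : ℝ) +
          A * M / ((b : ℝ) * N') + M) := ⟨_, rfl⟩
      obtain ⟨QO, hQO⟩ : ∃ q : ℝ, q = (b : ℝ) ^ (1 / 2 : ℝ) * A * (Li : ℝ) * N' ^ (3 / 4 : ℝ) *
          ((b : ℝ) ^ (1 / 4 : ℝ) * N' ^ (1 / 2 : ℝ) * (Li : ℝ) ^ (1 / 2 : ℝ) * M ^ (-(1 / 2) : ℝ) +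
            (Li : ℝ) ^ (5 / 2 : ℝ) * N' / M + N' ^ (1 / 4 : ℝ) * A ^ (-(1 / 2) : ℝ)) := ⟨_, rfl⟩
      -- `(M/Li²) QD ≤ T51(Li)` terms 1–3 and `(M/Li²) QO ≤` terms 4–6 (logarithmic coordinates)
      obtain ⟨lm, hlm⟩ : ∃ t : ℝ, t = Real.log M := ⟨_, rfl⟩
      obtain ⟨ln, hln⟩ : ∃ t : ℝ, t = Real.log N' := ⟨_, rfl⟩
      obtain ⟨lb, hlb⟩ : ∃ t : ℝ, t = Real.log b := ⟨_, rfl⟩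
      obtain ⟨la, hla⟩ : ∃ t : ℝ, t = Real.log A := ⟨_, rfl⟩
      obtain ⟨li, hli⟩ : ∃ t : ℝ, t = Real.log Li := ⟨_, rfl⟩
      have eM : ∀ c : ℝ, M ^ c = Real.exp (c * lm) := fun c => by
        rw [Real.rpow_def_of_pos hM0, mul_comm, hlm]
      have eN : ∀ c : ℝ, N' ^ c = Real.exp (c * ln) := fun c => by
        rw [Real.rpow_def_of_pos hN0, mul_comm, hln]
      have eb : ∀ c : ℝ, (b : ℝ) ^ c = Real.exp (c * lb) := fun c => by
        rw [Real.rpow_def_of_pos hb0, mul_comm, hlb]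
      have eA : ∀ c : ℝ, A ^ c = Real.exp (c * la) := fun c => by
        rw [Real.rpow_def_of_pos hA0, mul_comm, hla]
      have eL : ∀ c : ℝ, (Li : ℝ) ^ c = Real.exp (c * li) := fun c => by
        rw [Real.rpow_def_of_pos hLr0, mul_comm, hli]
      have eM1 : M = Real.exp lm := by rw [hlm, Real.exp_log hM0]
      have eN1 : N' = Real.exp ln := by rw [hln, Real.exp_log hN0]
      have eb1 : (b : ℝ) = Real.exp lb := by rw [hlb, Real.exp_log hb0]
      have eA1 : A = Real.exp la := by rw [hla, Real.exp_log hA0]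
      have eL1 : (Li : ℝ) = Real.exp li := by rw [hli, Real.exp_log hLr0]
      have eM2 : M ^ 2 = Real.exp (2 * lm) := by rw [eM1, ← Real.exp_nat_mul]; norm_num
      have eL2 : (Li : ℝ) ^ 2 = Real.exp (2 * li) := by rw [eL1, ← Real.exp_nat_mul]; norm_num
      have ebLN : ((b : ℝ) * (Li : ℝ) * N') ^ (1 / 2 : ℝ) = Real.exp (1 / 2 * (lb + li + ln)) := by
        have hl : Real.log ((b : ℝ) * (Li : ℝ) * N') = lb + li + ln := by
          rw [Real.log_mul (by positivity) hN0.ne', Real.log_mul hb0.ne' hLr0.ne', hlb, hli, hln]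
        rw [Real.rpow_def_of_pos (by positivity), hl, mul_comm]
      have ebN : ((b : ℝ) * N') ^ (1 / 2 : ℝ) = Real.exp (1 / 2 * (lb + ln)) := by
        have hl : Real.log ((b : ℝ) * N') = lb + ln := by
          rw [Real.log_mul hb0.ne' hN0.ne', hlb, hln]
        rw [Real.rpow_def_of_pos (by positivity), hl, mul_comm]
      have tD : M / (Li : ℝ) ^ 2 * QD ≤
          A * M * ((b : ℝ) * N') ^ (1 / 2 : ℝ) * (Li : ℝ) ^ (-(1 / 2) : ℝ) +
            A * M ^ 2 / ((b : ℝ) * (Li : ℝ) * N') + M ^ 2 / (Li : ℝ) := by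
        have e : M / (Li : ℝ) ^ 2 * QD =
            M / (Li : ℝ) ^ 2 * ((Li : ℝ) * (A * ((b : ℝ) * (Li : ℝ) * N') ^ (1 / 2 : ℝ))) +
            M / (Li : ℝ) ^ 2 * ((Li : ℝ) * (A * M / ((b : ℝ) * N'))) +
            M / (Li : ℝ) ^ 2 * ((Li : ℝ) * M) := by rw [hQD]; ring
        rw [e]
        have u1 : M / (Li : ℝ) ^ 2 * ((Li : ℝ) * (A * ((b : ℝ) * (Li : ℝ) * N') ^ (1 / 2 : ℝ))) ≤
            A * M * ((b : ℝ) * N') ^ (1 / 2 : ℝ) * (Li : ℝ) ^ (-(1 / 2) : ℝ) := by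
          rw [ebLN, ebN, eL, eL2, eM1, eA1, eL1]
          simp only [← Real.exp_add, ← Real.exp_sub]
          exact Real.exp_le_exp.mpr (le_of_eq (by ring))
        have u2 : M / (Li : ℝ) ^ 2 * ((Li : ℝ) * (A * M / ((b : ℝ) * N'))) ≤
            A * M ^ 2 / ((b : ℝ) * (Li : ℝ) * N') := by
          rw [eM2, eL2, eM1, eA1, eL1, eb1, eN1]
          simp only [← Real.exp_add, ← Real.exp_sub]
          exact Real.exp_le_exp.mpr (le_of_eq (by ring))
        have u3 : M / (Li : ℝ) ^ 2 * ((Li : ℝ) * M) ≤ M ^ 2 / (Li : ℝ) := by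
          rw [eM2, eL2, eM1, eL1]
          simp only [← Real.exp_add, ← Real.exp_sub]
          exact Real.exp_le_exp.mpr (le_of_eq (by ring))
        exact add_le_add (add_le_add u1 u2) u3
      have tO : M / (Li : ℝ) ^ 2 * QO ≤
          (b : ℝ) ^ (3 / 4 : ℝ) * A * M ^ (1 / 2 : ℝ) * N' ^ (5 / 4 : ℝ) * (Li : ℝ) ^ (-(1 / 2) : ℝ) +
            (b : ℝ) ^ (1 / 2 : ℝ) * A * (Li : ℝ) ^ (3 / 2 : ℝ) * N' ^ (7 / 4 : ℝ) +
            (b : ℝ) ^ (1 / 2 : ℝ) * A ^ (1 / 2 : ℝ) * M * N' / (Li : ℝ) := by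
        have e : M / (Li : ℝ) ^ 2 * QO =
            M / (Li : ℝ) ^ 2 * ((b : ℝ) ^ (1 / 2 : ℝ) * A * (Li : ℝ) * N' ^ (3 / 4 : ℝ) *
              ((b : ℝ) ^ (1 / 4 : ℝ) * N' ^ (1 / 2 : ℝ) * (Li : ℝ) ^ (1 / 2 : ℝ) * M ^ (-(1 / 2) : ℝ))) +
            M / (Li : ℝ) ^ 2 * ((b : ℝ) ^ (1 / 2 : ℝ) * A * (Li : ℝ) * N' ^ (3 / 4 : ℝ) *
              ((Li : ℝ) ^ (5 / 2 : ℝ) * N' / M)) +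
            M / (Li : ℝ) ^ 2 * ((b : ℝ) ^ (1 / 2 : ℝ) * A * (Li : ℝ) * N' ^ (3 / 4 : ℝ) *
              (N' ^ (1 / 4 : ℝ) * A ^ (-(1 / 2) : ℝ))) := by rw [hQO]; ring
        rw [e]
        have u4 : M / (Li : ℝ) ^ 2 * ((b : ℝ) ^ (1 / 2 : ℝ) * A * (Li : ℝ) * N' ^ (3 / 4 : ℝ) *
              ((b : ℝ) ^ (1 / 4 : ℝ) * N' ^ (1 / 2 : ℝ) * (Li : ℝ) ^ (1 / 2 : ℝ) * M ^ (-(1 / 2) : ℝ))) ≤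
            (b : ℝ) ^ (3 / 4 : ℝ) * A * M ^ (1 / 2 : ℝ) * N' ^ (5 / 4 : ℝ) * (Li : ℝ) ^ (-(1 / 2) : ℝ) := by
          rw [eb, eb, eb, eN, eN, eN, eL, eL, eM, eM, eL2, eM1, eA1, eL1]
          simp only [← Real.exp_add, ← Real.exp_sub]
          exact Real.exp_le_exp.mpr (le_of_eq (by ring))
        have u5 : M / (Li : ℝ) ^ 2 * ((b : ℝ) ^ (1 / 2 : ℝ) * A * (Li : ℝ) * N' ^ (3 / 4 : ℝ) *
              ((Li : ℝ) ^ (5 / 2 : ℝ) * N' / M)) ≤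
            (b : ℝ) ^ (1 / 2 : ℝ) * A * (Li : ℝ) ^ (3 / 2 : ℝ) * N' ^ (7 / 4 : ℝ) := by
          rw [eb, eN, eN, eL, eL, eL2, eM1, eA1, eL1, eN1]
          simp only [← Real.exp_add, ← Real.exp_sub]
          exact Real.exp_le_exp.mpr (le_of_eq (by ring))
        have u6 : M / (Li : ℝ) ^ 2 * ((b : ℝ) ^ (1 / 2 : ℝ) * A * (Li : ℝ) * N' ^ (3 / 4 : ℝ) *
              (N' ^ (1 / 4 : ℝ) * A ^ (-(1 / 2) : ℝ))) ≤
            (b : ℝ) ^ (1 / 2 : ℝ) * A ^ (1 / 2 : ℝ) * M * N' / (Li : ℝ) := by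
          rw [eb, eN, eN, eA, eA, eL2, eM1, eA1, eL1, eN1]
          simp only [← Real.exp_add, ← Real.exp_sub]
          exact Real.exp_le_exp.mpr (le_of_eq (by ring))
        exact add_le_add (add_le_add u4 u5) u6
      -- hence `(M/Li²)(KD QD + KO QO) ≤ (KD + KO) T51(Li) ≤ 2 (KD + KO) T51(L)`
      have hT51Li : T51 (Li : ℝ) = A * M * ((b : ℝ) * N') ^ (1 / 2 : ℝ) * (Li : ℝ) ^ (-(1 / 2) : ℝ) +
          A * M ^ 2 / ((b : ℝ) * (Li : ℝ) * N') + M ^ 2 / (Li : ℝ) +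
          (b : ℝ) ^ (3 / 4 : ℝ) * A * M ^ (1 / 2 : ℝ) * N' ^ (5 / 4 : ℝ) * (Li : ℝ) ^ (-(1 / 2) : ℝ) +
          (b : ℝ) ^ (1 / 2 : ℝ) * A * (Li : ℝ) ^ (3 / 2 : ℝ) * N' ^ (7 / 4 : ℝ) +
          (b : ℝ) ^ (1 / 2 : ℝ) * A ^ (1 / 2 : ℝ) * M * N' / (Li : ℝ) := by rw [hT51]
      have hfloor : T51 (Li : ℝ) ≤ 2 * T51 L := by
        rw [hT51]; exact BC_terms51A_floor_le hL1 hb hM0 hN0 hA0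
      have hcomb : M / (Li : ℝ) ^ 2 * (KD * QD + KO * QO) ≤ (KD + KO) * (2 * T51 L) := by
        have h1 : M / (Li : ℝ) ^ 2 * (KD * QD + KO * QO) =
            KD * (M / (Li : ℝ) ^ 2 * QD) + KO * (M / (Li : ℝ) ^ 2 * QO) := by ring
        rw [h1]
        have p123 : 0 ≤ A * M * ((b : ℝ) * N') ^ (1 / 2 : ℝ) * (Li : ℝ) ^ (-(1 / 2) : ℝ) +
            A * M ^ 2 / ((b : ℝ) * (Li : ℝ) * N') + M ^ 2 / (Li : ℝ) := by positivity
        have p456 : 0 ≤ (b : ℝ) ^ (3 / 4 : ℝ) * A * M ^ (1 / 2 : ℝ) * N' ^ (5 / 4 : ℝ) * (Li : ℝ) ^ (-(1 / 2) : ℝ) +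
            (b : ℝ) ^ (1 / 2 : ℝ) * A * (Li : ℝ) ^ (3 / 2 : ℝ) * N' ^ (7 / 4 : ℝ) +
            (b : ℝ) ^ (1 / 2 : ℝ) * A ^ (1 / 2 : ℝ) * M * N' / (Li : ℝ) := by positivity
        have hD' : M / (Li : ℝ) ^ 2 * QD ≤ T51 (Li : ℝ) := by
          rw [hT51Li]; exact tD.trans (le_add_of_nonneg_right p456 |>.trans_eq (by ring))
        have hO' : M / (Li : ℝ) ^ 2 * QO ≤ T51 (Li : ℝ) := by
          rw [hT51Li]; exact tO.trans (le_add_of_nonneg_left p123 |>.trans_eq (by ring))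
        have e1 := mul_le_mul_of_nonneg_left (hD'.trans hfloor) hKD0.le
        have e2 := mul_le_mul_of_nonneg_left (hO'.trans hfloor) hKO0.le
        calc _ ≤ KD * (2 * T51 L) + KO * (2 * T51 L) := add_le_add e1 e2
          _ = _ := by ring
      -- `(log Li)² ≤ Li^{2δ}/δ² ≤ M^{2δ}/δ²`, `x^{ε/2} M^{2δ} ≤ 8^{ε/4} x^ε`
      have hlogsq : Real.log Li ^ 2 ≤ (Li : ℝ) ^ (2 * δ) / δ ^ 2 := by
        have h1 : Real.log Li ≤ (Li : ℝ) ^ δ / δ := Real.log_le_rpow_div hLr0.le hδ0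
        have h2 : Real.log Li ^ 2 ≤ ((Li : ℝ) ^ δ / δ) ^ 2 := pow_le_pow_left₀ hlogLi.le h1 2
        calc Real.log Li ^ 2 ≤ ((Li : ℝ) ^ δ / δ) ^ 2 := h2
          _ = (Li : ℝ) ^ (2 * δ) / δ ^ 2 := by
              rw [div_pow, ← Real.rpow_two ((Li : ℝ) ^ δ), ← Real.rpow_mul hLr0.le]
              ring_nf
      have hLiM : (Li : ℝ) ^ (2 * δ) ≤ (2 * x) ^ (2 * δ) :=
        Real.rpow_le_rpow hLr0.le (by linarith) (by positivity)
      have hxx : x ^ (ε / 2) * (2 * x) ^ (2 * δ) ≤ (8 : ℝ) ^ (ε / 4) * x ^ ε := by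
        have e1 : (2 * x) ^ (2 * δ) = (2 : ℝ) ^ (ε / 4) * x ^ (ε / 4) := by
          rw [Real.mul_rpow (by norm_num) hx0.le, hδ]; ring_nf
        have e2 : (8 : ℝ) ^ (ε / 4) = (2 : ℝ) ^ (ε / 4) * (4 : ℝ) ^ (ε / 4) := by
          rw [show (8 : ℝ) = 2 * 4 by norm_num, Real.mul_rpow (by norm_num) (by norm_num)]
        have e3 : x ^ ε = x ^ (ε / 2) * x ^ (ε / 4) * x ^ (ε / 4) := by
          rw [← Real.rpow_add hx0, ← Real.rpow_add hx0]; ring_nf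
        have e4 : 1 ≤ (4 : ℝ) ^ (ε / 4) * x ^ (ε / 4) := by
          rw [← Real.mul_rpow (by norm_num) hx0.le]
          exact Real.one_le_rpow (by linarith) (by positivity)
        rw [e1, e2, e3]
        have h0 : 0 ≤ x ^ (ε / 2) * ((2 : ℝ) ^ (ε / 4) * x ^ (ε / 4)) := by positivity
        calc x ^ (ε / 2) * ((2 : ℝ) ^ (ε / 4) * x ^ (ε / 4))
            = x ^ (ε / 2) * ((2 : ℝ) ^ (ε / 4) * x ^ (ε / 4)) * 1 := (mul_one _).symm
          _ ≤ x ^ (ε / 2) * ((2 : ℝ) ^ (ε / 4) * x ^ (ε / 4)) * ((4 : ℝ) ^ (ε / 4) * x ^ (ε / 4)) :=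
              mul_le_mul_of_nonneg_left e4 h0
          _ = (2 : ℝ) ^ (ε / 4) * (4 : ℝ) ^ (ε / 4) * (x ^ (ε / 2) * x ^ (ε / 4) * x ^ (ε / 4)) := by ring
      -- `log (b |ϑ| m) ≤ Li / 4` for `m ≤ 2M`
      have hlogm : ∀ m : ℕ, 0 < m → (m : ℝ) ≤ 2 * M →
          Real.log b + Real.log ϑ.natAbs + Real.log m ≤ (Li : ℝ) / 4 := by
        intro m hm0 hm2
        have hϑ0 : (0 : ℝ) < ϑ.natAbs := by exact_mod_cast Int.natAbs_pos.mpr hϑ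
        have hm0' : (0 : ℝ) < m := by exact_mod_cast hm0
        have hprod : Real.log b + Real.log ϑ.natAbs + Real.log m =
            Real.log ((b : ℝ) * ϑ.natAbs * m) := by
          rw [Real.log_mul (by positivity) hm0'.ne', Real.log_mul hb0.ne' hϑ0.ne']
        have hkabs : ((ϑ.natAbs : ℕ) : ℝ) = |(ϑ : ℝ)| := by rw [Nat.cast_natAbs, Int.cast_abs]
        have hle : (b : ℝ) * ϑ.natAbs * m ≤ 8 * x := by
          rw [hx]
          have h1 : |(ϑ : ℝ)| ≤ 1 + |(ϑ : ℝ)| + |η| := by linarith [abs_nonneg η]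
          have h2 : (m : ℝ) * 1 * 1 ≤ 2 * M * (2 * N') * (2 * A) := by
            gcongr <;> linarith
          calc (b : ℝ) * ϑ.natAbs * m = |(ϑ : ℝ)| * ((b : ℝ) * ((m : ℝ) * 1 * 1)) := by rw [hkabs]; ring
            _ ≤ (1 + |(ϑ : ℝ)| + |η|) * ((b : ℝ) * (2 * M * (2 * N') * (2 * A))) := by gcongr
            _ = 8 * ((1 + |(ϑ : ℝ)| + |η|) * ((b : ℝ) * M * N' * A)) := by ring
        rw [hprod]
        calc Real.log ((b : ℝ) * ϑ.natAbs * m) ≤ Real.log (8 * x) :=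
              Real.log_le_log (by positivity) hle
          _ ≤ (L - 2) / 4 := by linarith
          _ ≤ (Li : ℝ) / 4 := by linarith
      -- the amplifier count `P = Li/(4 log Li) ≤ #{ℓ ∈ 𝓛 : (ℓ,m)=1}`
      set P : ℝ := (Li : ℝ) / (4 * Real.log Li) with hP
      have hP0 : 0 < P := by positivity
      have hSm : ∀ m ∈ (Ioc ⌊M⌋₊ ⌊2 * M⌋₊).filter (fun m => m.Coprime b), 0 < m ∧ (m : ℝ) ≤ 2 * M := by
        intro m hm
        simp only [Finset.mem_filter, Finset.mem_Ioc] at hm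
        refine ⟨by omega, ?_⟩
        calc (m : ℝ) ≤ (⌊2 * M⌋₊ : ℝ) := by exact_mod_cast hm.1.2
          _ ≤ 2 * M := Nat.floor_le (by linarith)
      have hP𝓛 : ∀ m ∈ (Ioc ⌊M⌋₊ ⌊2 * M⌋₊).filter (fun m => m.Coprime b),
          P ≤ (((((Ioc Li (2 * Li)).filter (fun ℓ => ℓ.Prime ∧ ℓ.Coprime b ∧ ℓ.Coprime ϑ.natAbs))).filter
            (fun ℓ => ℓ.Coprime m)).card : ℝ) := by
        intro m hm
        obtain ⟨hm0, hm2⟩ := hSm m hm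
        have h := kfp_primes_coprime_card hL₀ (L := Li) hLiL₀ hLi2 hb hϑ hm0
        have h2 : (Real.log b + Real.log ϑ.natAbs + Real.log m) / Real.log Li ≤
            (Li : ℝ) / 4 / Real.log Li := div_le_div_of_nonneg_right (hlogm m hm0 hm2) hlogLi.le
        have h3 : P = (Li : ℝ) / (2 * Real.log Li) - (Li : ℝ) / 4 / Real.log Li := by
          rw [hP]; field_simp; ring
        rw [h3]; linarith
      -- the amplified inequality
      have hamp := BC_amplified_moment_le_diag_add_off
        (fun m n' => γ n' * ∑ a ∈ Icc 1 ⌊2 * A⌋₊, ν a * Complex.exp (2 * Real.pi * Complex.I *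
                ((ϑ : ℂ) * (a : ℂ) * ((((m : ZMod (b * n'))⁻¹).val : ℕ) : ℂ) / ((b * n' : ℕ) : ℂ) +
                  (η : ℂ) * (a : ℂ) / ((m : ℂ) * ((b * n' : ℕ) : ℂ)))))
        (Icc 1 ⌊2 * N'⌋₊) ((Ioc Li (2 * Li)).filter (fun ℓ => ℓ.Prime ∧ ℓ.Coprime b ∧ ℓ.Coprime ϑ.natAbs))
        ((Ioc ⌊M⌋₊ ⌊2 * M⌋₊).filter (fun m => m.Coprime b)) M hSm hP0 hP𝓛
      have hDi := hKD b hb hbfull M N' A hM hN' hbN hbNM hA ϑ hϑ hbk η γ ν hγ hγ2 hν Li (by omega)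
      have hOi := hKO b hb hbfull M N' A hM hN' hbN hbNM hA ϑ hϑ hbk η γ ν hγ hγ2 hν Li (by omega)
      clear hKD hKO
      have hDi' := le_trans hDi (le_of_eq
        (show _ = KD * nrm * x ^ (ε / 2) * Wv * QD by rw [hnrm, hx, hWv, hQD]; ring))
      have hOi' := le_trans hOi (le_of_eq
        (show _ = KO * nrm * x ^ (ε / 2) * Wv * QO by rw [hnrm, hx, hWv, hQO]; ring))
      clear hDi hOi
      have hQD0 : 0 ≤ QD := by rw [hQD]; positivity
      have hQO0 : 0 ≤ QO := by rw [hQO]; positivity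
      -- assemble
      have h2MP : 2 * M / P ^ 2 = 32 * Real.log Li ^ 2 * (M / (Li : ℝ) ^ 2) := by
        rw [hP]; field_simp; ring
      have hsum : ‖∑ m ∈ (Ioc ⌊M⌋₊ ⌊2 * M⌋₊).filter (fun m => m.Coprime b), ∑ ℓ₁ ∈ ((Ioc Li (2 * Li)).filter (fun ℓ => ℓ.Prime ∧ ℓ.Coprime b ∧ ℓ.Coprime ϑ.natAbs)), ∑ n₁ ∈ Icc 1 ⌊2 * N'⌋₊,
          ∑ ℓ₂ ∈ ((Ioc Li (2 * Li)).filter (fun ℓ => ℓ.Prime ∧ ℓ.Coprime b ∧ ℓ.Coprime ϑ.natAbs)), ∑ n₂ ∈ Icc 1 ⌊2 * N'⌋₊,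
            (if ℓ₁ * n₁ = ℓ₂ * n₂ then
            (if (ℓ₂ * n₂).Coprime m ∧ ((ℓ₁ * n₁ : ℕ) : ZMod m) = ((ℓ₂ * n₂ : ℕ) : ZMod m) then
              (γ n₁ * ∑ a ∈ Icc 1 ⌊2 * A⌋₊, ν a * Complex.exp (2 * Real.pi * Complex.I *
                ((ϑ : ℂ) * (a : ℂ) * ((((m : ZMod (b * n₁))⁻¹).val : ℕ) : ℂ) / ((b * n₁ : ℕ) : ℂ) +
                  (η : ℂ) * (a : ℂ) / ((m : ℂ) * ((b * n₁ : ℕ) : ℂ))))) *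
              (starRingEnd ℂ) (γ n₂ * ∑ a ∈ Icc 1 ⌊2 * A⌋₊, ν a * Complex.exp (2 * Real.pi * Complex.I *
                ((ϑ : ℂ) * (a : ℂ) * ((((m : ZMod (b * n₂))⁻¹).val : ℕ) : ℂ) / ((b * n₂ : ℕ) : ℂ) +
                  (η : ℂ) * (a : ℂ) / ((m : ℂ) * ((b * n₂ : ℕ) : ℂ))))) else 0) else 0)‖ + ‖∑ m ∈ (Ioc ⌊M⌋₊ ⌊2 * M⌋₊).filter (fun m => m.Coprime b), ∑ ℓ₁ ∈ ((Ioc Li (2 * Li)).filter (fun ℓ => ℓ.Prime ∧ ℓ.Coprime b ∧ ℓ.Coprime ϑ.natAbs)), ∑ n₁ ∈ Icc 1 ⌊2 * N'⌋₊,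
          ∑ ℓ₂ ∈ ((Ioc Li (2 * Li)).filter (fun ℓ => ℓ.Prime ∧ ℓ.Coprime b ∧ ℓ.Coprime ϑ.natAbs)), ∑ n₂ ∈ Icc 1 ⌊2 * N'⌋₊,
            (if ℓ₁ * n₁ = ℓ₂ * n₂ then 0 else
            (if (ℓ₂ * n₂).Coprime m ∧ ((ℓ₁ * n₁ : ℕ) : ZMod m) = ((ℓ₂ * n₂ : ℕ) : ZMod m) then
              (γ n₁ * ∑ a ∈ Icc 1 ⌊2 * A⌋₊, ν a * Complex.exp (2 * Real.pi * Complex.I *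
                ((ϑ : ℂ) * (a : ℂ) * ((((m : ZMod (b * n₁))⁻¹).val : ℕ) : ℂ) / ((b * n₁ : ℕ) : ℂ) +
                  (η : ℂ) * (a : ℂ) / ((m : ℂ) * ((b * n₁ : ℕ) : ℂ))))) *
              (starRingEnd ℂ) (γ n₂ * ∑ a ∈ Icc 1 ⌊2 * A⌋₊, ν a * Complex.exp (2 * Real.pi * Complex.I *
                ((ϑ : ℂ) * (a : ℂ) * ((((m : ZMod (b * n₂))⁻¹).val : ℕ) : ℂ) / ((b * n₂ : ℕ) : ℂ) +
                  (η : ℂ) * (a : ℂ) / ((m : ℂ) * ((b * n₂ : ℕ) : ℂ))))) else 0))‖ ≤ nrm * x ^ (ε / 2) * Wv * (KD * QD + KO * QO) := by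
        calc _ ≤ KD * nrm * x ^ (ε / 2) * Wv * QD + KO * nrm * x ^ (ε / 2) * Wv * QO := add_le_add hDi' hOi'
          _ = _ := by ring
      have hE0 : 0 ≤ nrm * x ^ (ε / 2) * Wv := by positivity
      calc _ ≤ _ := hamp
        _ ≤ 2 * M / P ^ 2 * (nrm * x ^ (ε / 2) * Wv * (KD * QD + KO * QO)) :=
            mul_le_mul_of_nonneg_left hsum (by positivity)
        _ = 32 * Real.log Li ^ 2 * (nrm * x ^ (ε / 2) * Wv) * (M / (Li : ℝ) ^ 2 * (KD * QD + KO * QO)) := by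
            rw [h2MP]; ring
        _ ≤ 32 * ((Li : ℝ) ^ (2 * δ) / δ ^ 2) * (nrm * x ^ (ε / 2) * Wv) * ((KD + KO) * (2 * T51 L)) := by
            gcongr
        _ ≤ 32 * ((2 * x) ^ (2 * δ) / δ ^ 2) * (nrm * x ^ (ε / 2) * Wv) * ((KD + KO) * (2 * T51 L)) := by
            gcongr
        _ = 64 * (KD + KO) / δ ^ 2 * (x ^ (ε / 2) * (2 * x) ^ (2 * δ)) * nrm * Wv * T51 L := by
            field_simp; ring
        _ ≤ 64 * (KD + KO) / δ ^ 2 * ((8 : ℝ) ^ (ε / 4) * x ^ ε) * nrm * Wv * T51 L := by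
            gcongr
        _ = 64 * (KD + KO) * (8 : ℝ) ^ (ε / 4) / δ ^ 2 * nrm * x ^ ε * Wv * T51 L := by
            field_simp
        _ ≤ _ := by
            have e : (32 * (4 : ℝ) ^ ε + 64 * (KD + KO) * (8 : ℝ) ^ (ε / 4) / δ ^ 2) * nrm * x ^ ε * Wv * T51 L =
                32 * (4 : ℝ) ^ ε * nrm * x ^ ε * Wv * T51 L +
                64 * (KD + KO) * (8 : ℝ) ^ (ε / 4) / δ ^ 2 * nrm * x ^ ε * Wv * T51 L := by ring
            rw [e]; exact le_add_of_nonneg_left hK1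

end Literature.NumberTheory.LFunctions

end
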